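import Literature.MathematicalPhysics.QuantumFieldTheory.Balaban1983to89.B10Eq17LocalSolution
import Literature.MathematicalPhysics.QuantumFieldTheory.Balaban1983to89.B12SecondOrder267

/-!
# `Balaban1983to89.B10Eq17RecursiveSystem` — T. Bałaban, *Ultraviolet stability of three-dimensional lattice pure
gauge field theories*, Commun. Math. Phys. **102** (1985) 255–275 [Balaban1985UV3], the three sentences after
display (17) p. 260: «Denoting the terms by D̃⁽²⁾(A), we have QD̃⁽²⁾(A, c) = C⁽²⁾(A, c), and inspecting the formula
(124) [4] for Q we see easily that D̃⁽²⁾(A, b₀(c), c) can be expressed as a linear operator on g acting on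
C⁽²⁾(A, c). More generally we can get a system of recursive equations for terms in the expansion of D̃.» — the
RECURSIVE SYSTEM for the Taylor terms of the local solution of (17) as an identity of power-series expansions, and
its order-two member, PROVED on the carrier of `B10Eq17LocalSolution.Eq17Local` (every scalar field `𝕜`, the real
case of print included)

statement-level skeleton of published theorems with citation tags; proofs where landed; nothing here is a claim about
the Yang–Mills mass gap

PDF held: `paper:balaban1985-cmp102-uv-stability-3d` (journal page = PDF page + 254); p. 260 = `p0006.txt`; render
`run/shared/lean/pub/pub-balaban/b2b-balaban-ref1/pages/1985-cmp102-uv-stability-3d/…-p006-x2.png`.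

CITATION HEADER.  WHAT IS REPRODUCED: SKELETON row `B10.Eq17` of the mega-formalization `lit-balaban`
(`run/shared/lean/pub/lit-balaban/SKELETON.md` §B10; fold owner's rows `lit-balaban-r07/ROWS-B10.md`), member
sentences of p. 260 [PDF 6] quoted above — unit `lit-balaban-r07` (reader/typer of block B10), gen 20.  The same
sentence is printed for the template equation of «Sect. C in [7]» = [Balaban1985Variational] (56) p. 286 («From
Eq. (56) a sequence of recursive equations for D^{(n)} follows. It can be solved easily. For example we have …
D^{(2)}(A′) = C^{(2)}(LʲηA′), D^{(3)}(A′) = …», rows `B11.Eq55`, owner r08; orders two and three with remainder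
bounds: `B11Eq56Expansion`, `B11Eq56SeriesConcrete`, `B11Eq56Coefficients`, seats r08/p06) and for [Balaban1987RG1]
p. 267 («D̃(B) has an expansion beginning with quadratic terms, and D̃⁽²⁾(B) = C̃⁽²⁾(B)»: `B12SecondOrder267`, whose
generic second-order chain rule `fderiv_fderiv_comp_of_critical` and Taylor-coefficient lemmas are used here BY NAME).
What is NEW here is (i) the recursive system itself, for ALL orders at once, as the statement that the composite
formal power series `q ∘ (ι − H·p)` (`FormalMultilinearSeries.comp`; `q` an expansion of `C̃` at `0`, `p` one of
`D̃`, `ι` the identity series, `H` the support operator `hD̃` of p. 260) is again an expansion of `D̃` at `0`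
(Mathlib `HasFPowerSeriesAt.comp`) together with the RECURSION SHAPE: the order-`n` term of `q ∘ r` depends on `r`
only through its terms of order `< n` as soon as `q₁ = 0` (Mathlib `Composition.ne_single_iff`), so that the
order-`n` term of `D̃` is determined by `C̃` and the terms of `D̃` of orders `< n`; (ii) everything over an
arbitrary scalar field `𝕜` from the clauses of `Eq17Local 𝕜 …` alone (print's `A` is g-valued: `𝕜 = ℝ`).

DICTIONARY (as `B10SectAStatements` (17) / `B10Eq17LocalSolution`).  `A : β → X` (a g- or gᶜ-valued field on the
fine bonds `β`, sup norm), the unknown `D : C → X` of the cell's fixed-point form `D = C̃(A − hD)`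
(`B13PkLocalTerms.fpMap b₀ h C̃ A`; `D(c)` is print's `QD̃(A, c)`, and print's bond field `D̃(A, ·, c)`, supported
at the single bond `b₀(c)`, is `hD = B13PkLocalTerms.hOp b₀ h D`, `(hD)(b₀ c) = h(c)·D(c)` with `h(c)` a linear
operator on g — print: «D̃⁽²⁾(A, b₀(c), c) can be expressed as a linear operator on g acting on C⁽²⁾(A, c)»);
`C̃ = Ct : (β → X) → C → X` = print's `C` of (15) («analytic … starting at 2nd order»); `Dt` = the local solution
map of `Eq17Local 𝕜 b₀ h C̃ r δ Dt` (fixed point on `‖A‖ < r`, analytic there, `Dt 0 = 0`, `DDt(0) = 0`).  The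
support operator as a bounded operator is an explicit datum `H : (C → X) →L[𝕜] (β → X)` with
`hH : ∀ D, H D = hOpLin b₀ h D` (it exists under print's bound `‖h(c)x‖ ≤ b‖x‖`: `exists_support_clm`, and for
finite-dimensional g: `exists_support_clm_of_finiteDimensional`).  Print's `D̃⁽ⁿ⁾(A)` («the terms» of the Taylor
expansion) ↦ `p n (A, …, A)` for a power-series expansion `p` of `Dt` at `0` (`HasFPowerSeriesAt Dt p 0`); `C⁽ⁿ⁾`
↦ `q n (A, …, A)` likewise; the second-order terms also as the full second derivatives `fderiv (fderiv Dt) 0`,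
`fderiv (fderiv Ct) 0`.  `ι` := `(ContinuousLinearMap.id 𝕜 _).fpowerSeries 0` (the identity series).

WHAT THIS FILE PROVES (theorems only; no `def`, no named `Prop` fact; kernel, 0 sorry, standard axioms).
* §1 THE FIXED-POINT EQUATION `D(x) = C(x − H D(x))` NEAR `x = 0` over any `𝕜` (normed spaces `E`, `F`,
  `H : F →L[𝕜] E`, the equation holding eventually near `0`, `D 0 = 0`): `outer_zero` (`C 0 = 0`),
  `hasFDerivAt_inner` (`D(x − HD(x))(0) = 1` when `DD(0) = 0`), `fderiv_outer_zero` (`DD(0) = 0 ⇒ DC(0) = 0`),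
  **`fderiv_fderiv_eq`** (`D²D(0) = D²C(0)`, by name from `B12SecondOrder267.fderiv_fderiv_comp_of_critical`),
  `fderiv_fderiv_eq_of_analyticAt` (the same from analyticity at `0`); power series: `hasFPowerSeriesAt_inner`,
  **`hasFPowerSeriesAt_comp`** (THE RECURSIVE SYSTEM: `HasFPowerSeriesAt D (q.comp (ι − H·p)) 0`),
  **`comp_coeff_eq_of_eq_below`** (THE RECURSION SHAPE: `q₁ = 0`, `r`, `r′` equal below `n` ⇒
  `(q.comp r) n = (q.comp r′) n`), `comp_coeff_two` (`(q.comp (ι − H·p)) 2 = q 2` when `q₁ = 0`, `p₀ = p₁ = 0`),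
  `coeff_diag_eq_comp` / **`coeff_two_diag`** (for EVERY expansion `p` of `D` and `q` of `C` at `0`:
  `p n (y, …, y) = (q.comp (ι − H·p)) n (y, …, y)` and `p 2 (y, y) = q 2 (y, y)`; complete `F`, `char 𝕜 = 0`).
* §2 THE SAME IN THE LETTERS OF (17) from `h17 : Eq17Local 𝕜 b₀ h C̃ r δ Dt` and `H`, `hH` as above:
  `eq17Local_eventually_eq`, `eq17Local_analyticAt`, `eq17Local_Ct_zero`, `eq17Local_fderiv_Ct_zero` (print's «C …
  starting at 2nd order» is FORCED by (17)'s clauses), **`eq17Local_fderiv_fderiv_Dt_zero`** («QD̃⁽²⁾(A, c) =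
  C⁽²⁾(A, c)» as `fderiv (fderiv Dt) 0 = fderiv (fderiv Ct) 0`), **`eq17Local_hOp_second_order`** («D̃⁽²⁾(A, b₀(c), c)
  = h(c)·C⁽²⁾(A, c)»), `eq17Local_exists_powerSeries` (an expansion `p` of `Dt` at `0` with `p₀ = p₁ = 0`),
  **`eq17Local_hasFPowerSeriesAt_recursive`**, **`eq17Local_coeff_recursion`** (the order-`n` term of `D̃` is
  determined by `C̃` and the terms of `D̃` of orders `< n`: replacing `p` by ANY series `s` agreeing with `p` below `n`
  does not change `(q.comp (ι − H·p)) n`), `eq17Local_coeff_diag`, **`eq17Local_coeff_two_diag`**,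
  `eq17Local_hOp_coeff_two_diag`; `exists_support_clm`, `exists_support_clm_of_finiteDimensional`.
* §3 INSTANTIATION BY NAME for the two solution theorems of `B10Eq17LocalSolution`: `second_order_of_quadAnalytic`
  (the `ℂ` solution of `exists_solution`, data `QuadAnalytic C̃ C₂ R` + analytic) and `second_order_real` (the `ℝ`
  solution of `exists_eq17Local_real`, data `C^ω` with `C̃(0) = 0`, `DC̃(0) = 0`).

HONEST SCOPE.  (i) Print's formula (124) of [4] for `Q` (which makes `h(c)` explicit) is not used: `h(c)` is an
abstract linear operator on g, as in `B10Eq17LocalSolution`; (ii) the convergence of the full series is the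
analyticity clause of `Eq17Local` (proved in `B10Eq17LocalSolution` for the `ℂ` and `ℝ` data), not re-derived;
(iii) the closed third-order formula of [7] (56) is not restated here (it is `B11Eq56Expansion.eq56_order3` /
`B11Eq56Order3Concrete` on the B11 side); (iv) no lattice-specific statement.  NOT summit progress.
-/

open Metric Set Filter Topology
open scoped ContDiff

namespace Literature.MathematicalPhysics.QuantumFieldTheory.Balaban1983to89.B10Eq17RecursiveSystem

open B13PkLocalTerms B13Contraction113 B10Eq17LocalSolution B12SecondOrder267

/-! ## §1  The fixed-point equation `D(x) = C(x − H D(x))` near `x = 0`: orders one and two, and the recursive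
system as an identity of power-series expansions -/

section Generic

variable {𝕜 : Type*} [NontriviallyNormedField 𝕜] {E F : Type*} [NormedAddCommGroup E] [NormedSpace 𝕜 E]
  [NormedAddCommGroup F] [NormedSpace 𝕜 F] {D C : E → F} {H : F →L[𝕜] E}

/-- `D(0) = 0` and `D = C(· − HD·)` near `0` force `C(0) = 0`. [cite: Balaban1985UV3, (17) p.260] -/
theorem outer_zero (hfix : ∀ᶠ x in 𝓝 (0 : E), D x = C (x - H (D x))) (hD0 : D 0 = 0) : C 0 = 0 := by
  have h := hfix.self_of_nhds
  rw [hD0, map_zero, sub_zero] at h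
  exact h.symm

/-- The inner map `x ↦ x − H D(x)` of (17) is tangent to the identity at `0` when `DD(0) = 0` («Taylor expansion
beginning with second order terms»). [cite: Balaban1985UV3, (17) p.260] -/
theorem hasFDerivAt_inner (hD1 : HasFDerivAt D (0 : E →L[𝕜] F) 0) :
    HasFDerivAt (fun x => x - H (D x)) (ContinuousLinearMap.id 𝕜 E) 0 := by
  have h := (hasFDerivAt_id (𝕜 := 𝕜) (0 : E)).sub (H.hasFDerivAt.comp (0 : E) hD1)
  rw [ContinuousLinearMap.comp_zero, sub_zero] at h
  exact h.congr_of_eventuallyEq (Eventually.of_forall fun x => by simp)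

/-- **First order**: if `D = C(· − HD·)` near `0`, `D(0) = 0`, `DD(0) = 0` and `C` is differentiable at `0`, then
`DC(0) = 0` — print's «C(A′) is an analytic function … starting at 2nd order» ((15)) is forced by the clauses of
(17). [cite: Balaban1985UV3, (17) p.260] -/
theorem fderiv_outer_zero (hfix : ∀ᶠ x in 𝓝 (0 : E), D x = C (x - H (D x))) (hD0 : D 0 = 0)
    (hD1 : HasFDerivAt D (0 : E →L[𝕜] F) 0) (hC : DifferentiableAt 𝕜 C 0) : fderiv 𝕜 C 0 = 0 := by
  have h0 : (fun x => x - H (D x)) 0 = 0 := by simp [hD0]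
  have hC' : HasFDerivAt C (fderiv 𝕜 C 0) ((fun x => x - H (D x)) 0) := by
    rw [h0]; exact hC.hasFDerivAt
  have hCg : HasFDerivAt (C ∘ fun x => x - H (D x))
      ((fderiv 𝕜 C 0).comp (ContinuousLinearMap.id 𝕜 E)) 0 := hC'.comp (0 : E) (hasFDerivAt_inner hD1)
  have hDg : HasFDerivAt D ((fderiv 𝕜 C 0).comp (ContinuousLinearMap.id 𝕜 E)) 0 :=
    hCg.congr_of_eventuallyEq (hfix.mono fun x hx => by show D x = C (x - H (D x)); exact hx)
  have hu := hD1.unique hDg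
  rw [ContinuousLinearMap.comp_id] at hu
  exact hu.symm

/-- **Second order — «QD̃⁽²⁾(A, c) = C⁽²⁾(A, c)»** in abstract letters: if `D = C(· − HD·)` near `0`, `D(0) = 0`,
`DD(0) = 0`, `D` is differentiable near `0` with `DD` differentiable at `0`, and `C` is differentiable near `0`
with `DC` differentiable at `0`, then `D²D(0) = D²C(0)` (in `D²(C ∘ Φ) = D²C(DΦ·, DΦ·) + DC∘D²Φ` the second term
dies because `DC(0) = 0` and the first is `D²C(0)` because `DΦ(0) = 1`; `B12SecondOrder267.fderiv_fderiv_comp_of_critical`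
by name). [cite: Balaban1985UV3, (17) p.260] -/
theorem fderiv_fderiv_eq (hfix : ∀ᶠ x in 𝓝 (0 : E), D x = C (x - H (D x))) (hD0 : D 0 = 0)
    (hD1 : HasFDerivAt D (0 : E →L[𝕜] F) 0) (hDd : ∀ᶠ x in 𝓝 (0 : E), DifferentiableAt 𝕜 D x)
    (hD2 : DifferentiableAt 𝕜 (fderiv 𝕜 D) 0) (hCd : ∀ᶠ y in 𝓝 (0 : E), DifferentiableAt 𝕜 C y)
    (hC2 : DifferentiableAt 𝕜 (fderiv 𝕜 C) 0) :
    fderiv 𝕜 (fderiv 𝕜 D) 0 = fderiv 𝕜 (fderiv 𝕜 C) 0 := by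
  set g : E → E := fun x => x - H (D x) with hg
  have h0 : g 0 = 0 := by simp [hg, hD0]
  have heq : D =ᶠ[𝓝 0] C ∘ g := hfix.mono fun x hx => by show D x = C (x - H (D x)); exact hx
  rw [heq.fderiv.fderiv_eq]
  have hgd : ∀ᶠ y in 𝓝 (0 : E), DifferentiableAt 𝕜 g y :=
    hDd.mono fun y hy => differentiableAt_id.sub (H.differentiableAt.comp y hy)
  have hDg : fderiv 𝕜 g 0 = ContinuousLinearMap.id 𝕜 E := (hasFDerivAt_inner hD1).fderiv
  have hfg : fderiv 𝕜 g =ᶠ[𝓝 0] fun y =>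
      ContinuousLinearMap.id 𝕜 E - (ContinuousLinearMap.compL 𝕜 E F E H) (fderiv 𝕜 D y) := by
    filter_upwards [hDd] with y hy
    rw [ContinuousLinearMap.compL_apply]
    exact ((hasFDerivAt_id y).sub (H.hasFDerivAt.comp y hy.hasFDerivAt)).fderiv
  have hg2 : DifferentiableAt 𝕜 (fderiv 𝕜 g) 0 := by
    refine hfg.differentiableAt_iff.mpr ?_
    exact (((ContinuousLinearMap.compL 𝕜 E F E H).differentiableAt).comp (0 : E) hD2).const_sub _
  have hCd' : ∀ᶠ z in 𝓝 (g 0), DifferentiableAt 𝕜 C z := by rw [h0]; exact hCd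
  have hC2' : DifferentiableAt 𝕜 (fderiv 𝕜 C) (g 0) := by rw [h0]; exact hC2
  have hDf : fderiv 𝕜 C (g 0) = 0 := by
    rw [h0]; exact fderiv_outer_zero hfix hD0 hD1 hCd.self_of_nhds
  rw [fderiv_fderiv_comp_of_critical hgd hCd' hC2' hg2 hDf hDg, h0]

/-- The second-order identity from ANALYTICITY of `D` and `C` at `0` (the regularity clauses of (17) and (15)),
`F` complete. [cite: Balaban1985UV3, (17) p.260] -/
theorem fderiv_fderiv_eq_of_analyticAt [CompleteSpace F] (hfix : ∀ᶠ x in 𝓝 (0 : E), D x = C (x - H (D x)))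
    (hD0 : D 0 = 0) (hD1 : HasFDerivAt D (0 : E →L[𝕜] F) 0) (hDa : AnalyticAt 𝕜 D 0)
    (hCa : AnalyticAt 𝕜 C 0) : fderiv 𝕜 (fderiv 𝕜 D) 0 = fderiv 𝕜 (fderiv 𝕜 C) 0 :=
  fderiv_fderiv_eq hfix hD0 hD1 (hDa.eventually_analyticAt.mono fun _ h => h.differentiableAt)
    hDa.fderiv.differentiableAt (hCa.eventually_analyticAt.mono fun _ h => h.differentiableAt)
    hCa.fderiv.differentiableAt

/-! ### Power-series expansions: the recursive system -/

/-- The expansion of the inner map `x ↦ x − H D(x)` at `0` built from an expansion `p` of `D`: the identity series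
minus `H·p`. [cite: Balaban1985UV3, (17) p.260] -/
theorem hasFPowerSeriesAt_inner {p : FormalMultilinearSeries 𝕜 E F} (hp : HasFPowerSeriesAt D p 0) :
    HasFPowerSeriesAt (fun x => x - H (D x))
      ((ContinuousLinearMap.id 𝕜 E).fpowerSeries 0 - H.compFormalMultilinearSeries p) 0 := by
  obtain ⟨ρ, hρ⟩ := hp
  have h := ((ContinuousLinearMap.id 𝕜 E).hasFPowerSeriesAt 0).sub ⟨ρ, H.comp_hasFPowerSeriesOnBall hρ⟩
  exact h.congr (Eventually.of_forall fun x => by simp)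

/-- **THE RECURSIVE SYSTEM** («More generally we can get a system of recursive equations for terms in the expansion
of D̃»; [7] (56): «C_j(A′ − H Σ_m D^{(m)}(A′)) = Σ_n C^{(n)}(A′ − H Σ_m D^{(m)}(A′)) = Σ_n D^{(n)}(A′)»): if `p` is an
expansion of `D` at `0` and `q` one of `C` at `0`, then the COMPOSITE formal power series `q ∘ (ι − H·p)` is again
an expansion of `D` at `0`. [cite: Balaban1985UV3, (17) p.260] -/
theorem hasFPowerSeriesAt_comp (hfix : ∀ᶠ x in 𝓝 (0 : E), D x = C (x - H (D x))) (hD0 : D 0 = 0)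
    {p q : FormalMultilinearSeries 𝕜 E F} (hp : HasFPowerSeriesAt D p 0) (hq : HasFPowerSeriesAt C q 0) :
    HasFPowerSeriesAt D
      (q.comp ((ContinuousLinearMap.id 𝕜 E).fpowerSeries 0 - H.compFormalMultilinearSeries p)) 0 := by
  set g : E → E := fun x => x - H (D x) with hg
  have h0 : g 0 = 0 := by simp [hg, hD0]
  have hq' : HasFPowerSeriesAt C q (g 0) := by rw [h0]; exact hq
  have hg' : HasFPowerSeriesAt g
      ((ContinuousLinearMap.id 𝕜 E).fpowerSeries 0 - H.compFormalMultilinearSeries p) 0 :=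
    hasFPowerSeriesAt_inner hp
  exact (hq'.comp hg').congr (hfix.mono fun x hx => by show C (x - H (D x)) = D x; exact hx.symm)

/-- **THE RECURSION SHAPE**: when `q₁ = 0` (the outer map is critical at `0`), the order-`n` term of the composite
series `q ∘ r` depends on `r` only through its terms of orders `< n` — a composition of `n` with a block of size `n`
is the one-block composition, on which `q₁ = 0` acts (Mathlib `Composition.ne_single_iff`).  Hence with
`r = ι − H·p` the order-`n` term of `D` is determined by `C` and the terms of `D` of orders `< n`: the equations are
RECURSIVE. [cite: Balaban1985UV3, (17) p.260] -/
theorem comp_coeff_eq_of_eq_below {q : FormalMultilinearSeries 𝕜 E F} (hq1 : q 1 = 0)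
    {r r' : FormalMultilinearSeries 𝕜 E E} {n : ℕ} (h : ∀ m < n, r m = r' m) :
    q.comp r n = q.comp r' n := by
  rcases Nat.eq_zero_or_pos n with rfl | hn
  · rw [FormalMultilinearSeries.comp_coeff_zero'', FormalMultilinearSeries.comp_coeff_zero'']
  · change (∑ c : Composition n, q.compAlongComposition r c) =
      ∑ c : Composition n, q.compAlongComposition r' c
    refine Finset.sum_congr rfl fun c _ => ?_
    by_cases hc : c = Composition.single n hn
    · have hl : c.length = 1 := by rw [hc]; exact Composition.single_length hn
      have hz : q c.length = 0 := by rw [hl]; exact hq1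
      ext v
      rw [FormalMultilinearSeries.compAlongComposition_apply,
        FormalMultilinearSeries.compAlongComposition_apply, hz]
      simp
    · have hlt := (Composition.ne_single_iff hn).1 hc
      ext v
      rw [FormalMultilinearSeries.compAlongComposition_apply,
        FormalMultilinearSeries.compAlongComposition_apply]
      congr 1
      funext i
      change r (c.blocksFun i) (v ∘ c.embedding i) = r' (c.blocksFun i) (v ∘ c.embedding i)
      rw [h _ (hlt i)]

/-- The identity series at `0`, written with Mathlib's `FormalMultilinearSeries.id`. [cite: Balaban1985UV3, (17) p.260] -/
theorem id_fpowerSeries_zero :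
    (ContinuousLinearMap.id 𝕜 E).fpowerSeries 0 = FormalMultilinearSeries.id 𝕜 E 0 := by
  ext n v
  rcases n with _ | _ | n
  · simp
  · simp
  · simp

/-- **Order two of the recursive system**: with `q₁ = 0` and `p₀ = p₁ = 0` the series `ι − H·p` agrees with the
identity series below order `2`, so `(q ∘ (ι − H·p))₂ = (q ∘ ι)₂ = q₂` — «QD̃⁽²⁾(A, c) = C⁽²⁾(A, c)» at the level
of formal series. [cite: Balaban1985UV3, (17) p.260] -/
theorem comp_coeff_two {q : FormalMultilinearSeries 𝕜 E F} (hq1 : q 1 = 0) {p : FormalMultilinearSeries 𝕜 E F}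
    (hp0 : p 0 = 0) (hp1 : p 1 = 0) :
    q.comp ((ContinuousLinearMap.id 𝕜 E).fpowerSeries 0 - H.compFormalMultilinearSeries p) 2 = q 2 := by
  have h : ∀ m < 2, ((ContinuousLinearMap.id 𝕜 E).fpowerSeries 0 - H.compFormalMultilinearSeries p) m =
      (FormalMultilinearSeries.id 𝕜 E 0) m := by
    intro m hm
    rw [← id_fpowerSeries_zero]
    change (ContinuousLinearMap.id 𝕜 E).fpowerSeries 0 m - H.compFormalMultilinearSeries p m = _
    rw [ContinuousLinearMap.compFormalMultilinearSeries_apply]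
    interval_cases m
    · rw [hp0, sub_eq_self]; ext v; simp
    · rw [hp1, sub_eq_self]; ext v; simp
  rw [comp_coeff_eq_of_eq_below hq1 h, FormalMultilinearSeries.comp_id]

/-- An expansion of `D` at `0` has `p₀ = 0` (`D(0) = 0`) and `p₁ = 0` (`DD(0) = 0`): «a Taylor expansion beginning
with second order terms». [cite: Balaban1985UV3, (17) p.260] -/
theorem coeff_zero_one (hD0 : D 0 = 0) (hD1 : HasFDerivAt D (0 : E →L[𝕜] F) 0)
    {p : FormalMultilinearSeries 𝕜 E F} (hp : HasFPowerSeriesAt D p 0) : p 0 = 0 ∧ p 1 = 0 :=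
  ⟨coeff_zero_eq_zero hp hD0, coeff_one_eq_zero hp hD1.fderiv⟩

variable [CompleteSpace F] [CharZero 𝕜]

/-- **The terms of `D̃` satisfy the recursive system**: for EVERY expansion `p` of `D` at `0` and `q` of `C` at `0`,
the homogeneous term of order `n` of `D`, `p n (y, …, y)`, equals the order-`n` term of the composite series
`q ∘ (ι − H·p)` on the diagonal (both are `(n!)⁻¹Dⁿ D(0)(y, …, y)`; complete `F`, `char 𝕜 = 0`).
[cite: Balaban1985UV3, (17) p.260] -/
theorem coeff_diag_eq_comp (hfix : ∀ᶠ x in 𝓝 (0 : E), D x = C (x - H (D x))) (hD0 : D 0 = 0)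
    {p q : FormalMultilinearSeries 𝕜 E F} (hp : HasFPowerSeriesAt D p 0) (hq : HasFPowerSeriesAt C q 0)
    (n : ℕ) (y : E) :
    p n (fun _ => y) =
      (q.comp ((ContinuousLinearMap.id 𝕜 E).fpowerSeries 0 - H.compFormalMultilinearSeries p)) n
        (fun _ => y) := by
  rw [coeff_diag_eq_inv_factorial_smul hp, coeff_diag_eq_inv_factorial_smul (hasFPowerSeriesAt_comp hfix hD0 hp hq)]

/-- **«QD̃⁽²⁾(A, c) = C⁽²⁾(A, c)» for the homogeneous quadratic terms**: for EVERY expansion `p` of `D` and `q` of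
`C` at `0`, `p 2 (y, y) = q 2 (y, y)` (with `D(0) = 0`, `DD(0) = 0`, `D = C(· − HD·)` near `0`; complete `F`,
`char 𝕜 = 0`). [cite: Balaban1985UV3, (17) p.260] -/
theorem coeff_two_diag (hfix : ∀ᶠ x in 𝓝 (0 : E), D x = C (x - H (D x))) (hD0 : D 0 = 0)
    (hD1 : HasFDerivAt D (0 : E →L[𝕜] F) 0) {p q : FormalMultilinearSeries 𝕜 E F}
    (hp : HasFPowerSeriesAt D p 0) (hq : HasFPowerSeriesAt C q 0) (y : E) :
    p 2 (fun _ => y) = q 2 (fun _ => y) := by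
  obtain ⟨hp0, hp1⟩ := coeff_zero_one hD0 hD1 hp
  have hq1 : q 1 = 0 := coeff_one_eq_zero hq (fderiv_outer_zero hfix hD0 hD1 hq.differentiableAt)
  rw [coeff_diag_eq_comp hfix hD0 hp hq 2 y, comp_coeff_two hq1 hp0 hp1]

end Generic

/-! ## §2  The same in the letters of (17): consequences of `Eq17Local 𝕜 b₀ h C̃ r δ Dt` -/

section B10

variable {𝕜 : Type*} [NontriviallyNormedField 𝕜] {β C X : Type*} [Fintype β] [Fintype C]
  [NormedAddCommGroup X] [NormedSpace 𝕜 X]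
  {b₀ : C → β} {h : C → X →ₗ[𝕜] X} {Ct : (β → X) → C → X} {r δ : ℝ} {Dt : (β → X) → C → X}

/-- **The support operator `hD̃` of p. 260 as a bounded operator**, under print's bound `‖h(c)x‖ ≤ b‖x‖`: there is
`H : (C → X) →L[𝕜] (β → X)` with `H D = hOpLin b₀ h D` (`LinearMap.mkContinuous` with `norm_hOpLin_le`).
[cite: Balaban1985UV3, (17) p.260] -/
theorem exists_support_clm (b₀ : C → β) (h : C → X →ₗ[𝕜] X) {b : ℝ} (hb : 0 ≤ b)
    (hh : ∀ c x, ‖h c x‖ ≤ b * ‖x‖) :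
    ∃ H : (C → X) →L[𝕜] (β → X), ∀ D, H D = hOpLin b₀ h D :=
  ⟨(hOpLin b₀ h).mkContinuous b (norm_hOpLin_le b₀ h hb hh), fun D => LinearMap.mkContinuous_apply _ _ _ D⟩

omit [Fintype β] in
/-- For a finite-dimensional Lie algebra over a complete field (print: g = the Lie algebra of a compact `G`, `𝕜 = ℝ`)
every `h` gives a bounded support operator. [cite: Balaban1985UV3, (17) p.260] -/
theorem exists_support_clm_of_finiteDimensional [CompleteSpace 𝕜] [FiniteDimensional 𝕜 X] (b₀ : C → β)
    (h : C → X →ₗ[𝕜] X) : ∃ H : (C → X) →L[𝕜] (β → X), ∀ D, H D = hOpLin b₀ h D :=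
  ⟨LinearMap.toContinuousLinearMap (hOpLin b₀ h), fun _ => rfl⟩

/-- From `Eq17Local`: the equation (17), `Dt A = C̃(A − hDt A)`, holds for all `A` near `0`.
[cite: Balaban1985UV3, (17) p.260] -/
theorem eq17Local_eventually_eq (h17 : Eq17Local 𝕜 b₀ (fun c => ⇑(h c)) Ct r δ Dt)
    (H : (C → X) →L[𝕜] (β → X)) (hH : ∀ D, H D = hOpLin b₀ h D) :
    ∀ᶠ A in 𝓝 (0 : β → X), Dt A = Ct (A - H (Dt A)) := by
  obtain ⟨hr, -, hfix, -, -, -⟩ := h17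
  filter_upwards [ball_mem_nhds (0 : β → X) hr] with A hA
  have h1 : fpMap b₀ (fun c => ⇑(h c)) Ct A (Dt A) = Dt A := (hfix A (mem_ball_zero_iff.mp hA)).1
  rw [fpMap_eq_hOpLin] at h1
  rw [hH]
  exact h1.symm

/-- From `Eq17Local`: `Dt` is analytic at `0` (the analyticity clause on the open ball `‖A‖ < r`).
[cite: Balaban1985UV3, (17) p.260] -/
theorem eq17Local_analyticAt (h17 : Eq17Local 𝕜 b₀ (fun c => ⇑(h c)) Ct r δ Dt) : AnalyticAt 𝕜 Dt 0 := by
  obtain ⟨hr, -, -, han, -, -⟩ := h17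
  exact (isOpen_ball.analyticOn_iff_analyticOnNhd.mp han) 0 (mem_ball_self hr)

/-- From `Eq17Local`: `C̃(0) = 0`. [cite: Balaban1985UV3, (17) p.260] -/
theorem eq17Local_Ct_zero (h17 : Eq17Local 𝕜 b₀ (fun c => ⇑(h c)) Ct r δ Dt)
    (H : (C → X) →L[𝕜] (β → X)) (hH : ∀ D, H D = hOpLin b₀ h D) : Ct 0 = 0 :=
  outer_zero (eq17Local_eventually_eq h17 H hH) h17.2.2.2.2.1

/-- **`DC̃(0) = 0` is forced by (17)** (`Dt 0 = 0`, `DDt(0) = 0`, `C̃` differentiable at `0`): print's «C … with an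
expansion starting at 2nd order» ((15)) read back from the clauses of (17). [cite: Balaban1985UV3, (17) p.260] -/
theorem eq17Local_fderiv_Ct_zero (h17 : Eq17Local 𝕜 b₀ (fun c => ⇑(h c)) Ct r δ Dt)
    (H : (C → X) →L[𝕜] (β → X)) (hH : ∀ D, H D = hOpLin b₀ h D) (hC : DifferentiableAt 𝕜 Ct 0) :
    fderiv 𝕜 Ct 0 = 0 :=
  fderiv_outer_zero (eq17Local_eventually_eq h17 H hH) h17.2.2.2.2.1 h17.2.2.2.2.2 hC

/-- **«QD̃⁽²⁾(A, c) = C⁽²⁾(A, c)»**: for the local solution of (17) and `C̃` analytic at `0`, the second Fréchet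
derivatives at `0` coincide, `D²Dt(0) = D²C̃(0)` (the cell's `D(c)` IS print's `QD̃(A, c)`; complete `X`).
[cite: Balaban1985UV3, (17) p.260] -/
theorem eq17Local_fderiv_fderiv_Dt_zero [CompleteSpace X] (h17 : Eq17Local 𝕜 b₀ (fun c => ⇑(h c)) Ct r δ Dt)
    (H : (C → X) →L[𝕜] (β → X)) (hH : ∀ D, H D = hOpLin b₀ h D) (hCa : AnalyticAt 𝕜 Ct 0) :
    fderiv 𝕜 (fderiv 𝕜 Dt) 0 = fderiv 𝕜 (fderiv 𝕜 Ct) 0 :=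
  fderiv_fderiv_eq_of_analyticAt (eq17Local_eventually_eq h17 H hH) h17.2.2.2.2.1 h17.2.2.2.2.2
    (eq17Local_analyticAt h17) hCa

/-- **«D̃⁽²⁾(A, b₀(c), c) can be expressed as a linear operator on g acting on C⁽²⁾(A, c)»**: the bond field of the
second-order term, `hD̃⁽²⁾`, takes at the bond `b₀(c)` the value `h(c)·C⁽²⁾(·, ·)(c)` (here on the full second
derivatives; `b₀` injective). [cite: Balaban1985UV3, (17) p.260] -/
theorem eq17Local_hOp_second_order [CompleteSpace X] (h17 : Eq17Local 𝕜 b₀ (fun c => ⇑(h c)) Ct r δ Dt)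
    (H : (C → X) →L[𝕜] (β → X)) (hH : ∀ D, H D = hOpLin b₀ h D) (hCa : AnalyticAt 𝕜 Ct 0)
    (hb : Function.Injective b₀) (u v : β → X) (c : C) :
    hOpLin b₀ h (fderiv 𝕜 (fderiv 𝕜 Dt) 0 u v) (b₀ c) = h c (fderiv 𝕜 (fderiv 𝕜 Ct) 0 u v c) := by
  rw [eq17Local_fderiv_fderiv_Dt_zero h17 H hH hCa, hOpLin_apply, hOp_apply_b₀ hb]

/-- From `Eq17Local`: `Dt` HAS a power-series expansion at `0`, and every such expansion begins with second-order
terms (`p₀ = 0`, `p₁ = 0`). [cite: Balaban1985UV3, (17) p.260] -/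
theorem eq17Local_exists_powerSeries (h17 : Eq17Local 𝕜 b₀ (fun c => ⇑(h c)) Ct r δ Dt) :
    (∃ p : FormalMultilinearSeries 𝕜 (β → X) (C → X), HasFPowerSeriesAt Dt p 0) ∧
      ∀ p : FormalMultilinearSeries 𝕜 (β → X) (C → X), HasFPowerSeriesAt Dt p 0 → p 0 = 0 ∧ p 1 = 0 :=
  ⟨eq17Local_analyticAt h17, fun _ hp => coeff_zero_one h17.2.2.2.2.1 h17.2.2.2.2.2 hp⟩

/-- **THE RECURSIVE SYSTEM for (17)**: for every expansion `p` of the local solution `Dt` at `0` and `q` of `C̃` at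
`0`, the composite series `q ∘ (ι − H·p)` — print's «C(A − D̃(A, c), c)» expanded — is again an expansion of `Dt`
at `0`. [cite: Balaban1985UV3, (17) p.260] -/
theorem eq17Local_hasFPowerSeriesAt_recursive (h17 : Eq17Local 𝕜 b₀ (fun c => ⇑(h c)) Ct r δ Dt)
    (H : (C → X) →L[𝕜] (β → X)) (hH : ∀ D, H D = hOpLin b₀ h D)
    {p q : FormalMultilinearSeries 𝕜 (β → X) (C → X)} (hp : HasFPowerSeriesAt Dt p 0)
    (hq : HasFPowerSeriesAt Ct q 0) :
    HasFPowerSeriesAt Dt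
      (q.comp ((ContinuousLinearMap.id 𝕜 (β → X)).fpowerSeries 0 - H.compFormalMultilinearSeries p)) 0 :=
  hasFPowerSeriesAt_comp (eq17Local_eventually_eq h17 H hH) h17.2.2.2.2.1 hp hq

/-- **The equations are RECURSIVE**: the order-`n` term of the composite series `q ∘ (ι − H·p)` is unchanged when
`p` is replaced by ANY series `s` agreeing with `p` in orders `< n` — the order-`n` term of `D̃` is determined by
`C̃` and `D̃⁽ᵐ⁾`, `m < n` (uses `DC̃(0) = 0`, i.e. `q₁ = 0`, derived above). [cite: Balaban1985UV3, (17) p.260] -/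
theorem eq17Local_coeff_recursion (h17 : Eq17Local 𝕜 b₀ (fun c => ⇑(h c)) Ct r δ Dt)
    (H : (C → X) →L[𝕜] (β → X)) (hH : ∀ D, H D = hOpLin b₀ h D)
    {q : FormalMultilinearSeries 𝕜 (β → X) (C → X)} (hq : HasFPowerSeriesAt Ct q 0)
    (p s : FormalMultilinearSeries 𝕜 (β → X) (C → X)) {n : ℕ} (hs : ∀ m < n, s m = p m) :
    q.comp ((ContinuousLinearMap.id 𝕜 (β → X)).fpowerSeries 0 - H.compFormalMultilinearSeries p) n =
      q.comp ((ContinuousLinearMap.id 𝕜 (β → X)).fpowerSeries 0 - H.compFormalMultilinearSeries s) n := by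
  have hq1 : q 1 = 0 := coeff_one_eq_zero hq (eq17Local_fderiv_Ct_zero h17 H hH hq.differentiableAt)
  refine comp_coeff_eq_of_eq_below hq1 fun m hm => ?_
  change (ContinuousLinearMap.id 𝕜 (β → X)).fpowerSeries 0 m - H.compFormalMultilinearSeries p m =
    (ContinuousLinearMap.id 𝕜 (β → X)).fpowerSeries 0 m - H.compFormalMultilinearSeries s m
  rw [ContinuousLinearMap.compFormalMultilinearSeries_apply, ContinuousLinearMap.compFormalMultilinearSeries_apply,
    hs m hm]

variable [CompleteSpace X] [CharZero 𝕜]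

/-- **The Taylor terms `D̃⁽ⁿ⁾(A)` obey the recursive system**: for every expansion `p` of `Dt` and `q` of `C̃` at
`0`, `p n (A, …, A) = (q ∘ (ι − H·p)) n (A, …, A)` (complete `X`, `char 𝕜 = 0`). [cite: Balaban1985UV3, (17) p.260] -/
theorem eq17Local_coeff_diag (h17 : Eq17Local 𝕜 b₀ (fun c => ⇑(h c)) Ct r δ Dt)
    (H : (C → X) →L[𝕜] (β → X)) (hH : ∀ D, H D = hOpLin b₀ h D)
    {p q : FormalMultilinearSeries 𝕜 (β → X) (C → X)} (hp : HasFPowerSeriesAt Dt p 0)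
    (hq : HasFPowerSeriesAt Ct q 0) (n : ℕ) (A : β → X) :
    p n (fun _ => A) =
      (q.comp ((ContinuousLinearMap.id 𝕜 (β → X)).fpowerSeries 0 - H.compFormalMultilinearSeries p)) n
        (fun _ => A) :=
  coeff_diag_eq_comp (eq17Local_eventually_eq h17 H hH) h17.2.2.2.2.1 hp hq n A

/-- **«Denoting the terms by D̃⁽²⁾(A), we have QD̃⁽²⁾(A, c) = C⁽²⁾(A, c)»**: for every expansion `p` of the local
solution `Dt` and `q` of `C̃` at `0`, the homogeneous quadratic terms agree, `p 2 (A, A) = q 2 (A, A)` (complete `X`,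
`char 𝕜 = 0`). [cite: Balaban1985UV3, (17) p.260] -/
theorem eq17Local_coeff_two_diag (h17 : Eq17Local 𝕜 b₀ (fun c => ⇑(h c)) Ct r δ Dt)
    (H : (C → X) →L[𝕜] (β → X)) (hH : ∀ D, H D = hOpLin b₀ h D)
    {p q : FormalMultilinearSeries 𝕜 (β → X) (C → X)} (hp : HasFPowerSeriesAt Dt p 0)
    (hq : HasFPowerSeriesAt Ct q 0) (A : β → X) : p 2 (fun _ => A) = q 2 (fun _ => A) :=
  coeff_two_diag (eq17Local_eventually_eq h17 H hH) h17.2.2.2.2.1 h17.2.2.2.2.2 hp hq A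

/-- **«D̃⁽²⁾(A, b₀(c), c) = (a linear operator on g) · C⁽²⁾(A, c)»** for the homogeneous quadratic terms: the bond
field `hD̃⁽²⁾(A)` at `b₀(c)` is `h(c)·(q 2 (A, A))(c)` (`b₀` injective). [cite: Balaban1985UV3, (17) p.260] -/
theorem eq17Local_hOp_coeff_two_diag (h17 : Eq17Local 𝕜 b₀ (fun c => ⇑(h c)) Ct r δ Dt)
    (H : (C → X) →L[𝕜] (β → X)) (hH : ∀ D, H D = hOpLin b₀ h D)
    {p q : FormalMultilinearSeries 𝕜 (β → X) (C → X)} (hp : HasFPowerSeriesAt Dt p 0)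
    (hq : HasFPowerSeriesAt Ct q 0) (hb : Function.Injective b₀) (A : β → X) (c : C) :
    hOpLin b₀ h (p 2 (fun _ => A)) (b₀ c) = h c (q 2 (fun _ => A) c) := by
  rw [eq17Local_coeff_two_diag h17 H hH hp hq A, hOpLin_apply, hOp_apply_b₀ hb]

end B10

/-! ## §3  Instantiation by name for the two solution theorems of `B10Eq17LocalSolution` -/

section Instances

variable {β C : Type*} [Fintype β] [Fintype C]

/-- **Second order and the recursive system for THE `ℂ` SOLUTION of (17)** produced by
`B10Eq17LocalSolution.exists_solution` (data: `C̃` with the printed quadratic bound `QuadAnalytic C̃ C₂ R` and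
analytic on `‖Y‖ < R`, `‖h(c)x‖ ≤ b‖x‖`, `9C₂bε < 1`, `3ε ≤ R`): the solution `Dt` satisfies
`Eq17Local ℂ b₀ h C̃ ε (4C₂ε²) Dt`, `D²Dt(0) = D²C̃(0)`, and for all expansions `p` of `Dt`, `q` of `C̃` at `0`:
`q ∘ (ι − H·p)` is an expansion of `Dt` at `0` and `p 2 (A, A) = q 2 (A, A)`, with `H` the bounded support
operator. [cite: Balaban1985UV3, (17) p.260] -/
theorem second_order_of_quadAnalytic {X : Type*} [NormedAddCommGroup X] [NormedSpace ℂ X] [CompleteSpace X]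
    (b₀ : C → β) (h : C → X →ₗ[ℂ] X) {Ct : (β → X) → C → X} {C₂ R b ε : ℝ} (hC : QuadAnalytic Ct C₂ R)
    (hCa : AnalyticOnNhd ℂ Ct {Y : β → X | ‖Y‖ < R}) (hC₂ : 0 ≤ C₂) (hb : 0 ≤ b)
    (hh : ∀ c x, ‖h c x‖ ≤ b * ‖x‖) (hε : 0 < ε) (hq : 9 * C₂ * b * ε < 1) (hRC : 3 * ε ≤ R) :
    ∃ Dt : (β → X) → (C → X), Eq17Local ℂ b₀ (fun c => ⇑(h c)) Ct ε (4 * C₂ * ε ^ 2) Dt ∧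
      fderiv ℂ (fderiv ℂ Dt) 0 = fderiv ℂ (fderiv ℂ Ct) 0 ∧
      ∀ p q : FormalMultilinearSeries ℂ (β → X) (C → X), HasFPowerSeriesAt Dt p 0 → HasFPowerSeriesAt Ct q 0 →
        HasFPowerSeriesAt Dt (q.comp ((ContinuousLinearMap.id ℂ (β → X)).fpowerSeries 0 -
          ((hOpLin b₀ h).mkContinuous b (norm_hOpLin_le b₀ h hb hh)).compFormalMultilinearSeries p)) 0 ∧
        ∀ A : β → X, p 2 (fun _ => A) = q 2 (fun _ => A) := by
  obtain ⟨Dt, h17⟩ := exists_eq17Local b₀ h hC hCa hC₂ hb hh hε hq hRC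
  set H : (C → X) →L[ℂ] (β → X) := (hOpLin b₀ h).mkContinuous b (norm_hOpLin_le b₀ h hb hh) with hHdef
  have hH : ∀ D, H D = hOpLin b₀ h D := fun D => LinearMap.mkContinuous_apply _ _ _ D
  have h0R : (0 : β → X) ∈ {Y : β → X | ‖Y‖ < R} := by
    simp only [mem_setOf_eq, norm_zero]; linarith
  have hCa0 : AnalyticAt ℂ Ct 0 := hCa 0 h0R
  exact ⟨Dt, h17, eq17Local_fderiv_fderiv_Dt_zero h17 H hH hCa0, fun p q hp hq' =>
    ⟨eq17Local_hasFPowerSeriesAt_recursive h17 H hH hp hq', fun A => eq17Local_coeff_two_diag h17 H hH hp hq' A⟩⟩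

/-- **Second order and the recursive system for THE REAL SOLUTION of (17)** (print's own setting: `A` g-valued,
«analytic» = real-analytic) produced by `B10Eq17LocalSolution.exists_eq17Local_real` (data: `C̃` real-analytic
(`C^ω`) on a ball around `0` with `C̃(0) = 0`, `DC̃(0) = 0`, `‖h(c)x‖ ≤ b‖x‖`): for some `r`, `δ > 0` the solution
`Dt` satisfies `Eq17Local ℝ b₀ h C̃ r δ Dt`, `D²Dt(0) = D²C̃(0)`, and for all expansions `p` of `Dt`, `q` of `C̃` at
`0`: `q ∘ (ι − H·p)` is an expansion of `Dt` at `0` and `p 2 (A, A) = q 2 (A, A)`. [cite: Balaban1985UV3, (17) p.260] -/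
theorem second_order_real {X : Type*} [NormedAddCommGroup X] [NormedSpace ℝ X] [CompleteSpace X]
    (b₀ : C → β) (h : C → X →ₗ[ℝ] X) {Ct : (β → X) → C → X} {R b : ℝ} (hR : 0 < R)
    (hCω : ContDiffOn ℝ ω Ct (ball 0 R)) (hC0 : Ct 0 = 0) (hDC0 : fderiv ℝ Ct 0 = 0) (hb : 0 ≤ b)
    (hh : ∀ c x, ‖h c x‖ ≤ b * ‖x‖) :
    ∃ r δ : ℝ, 0 < δ ∧ ∃ Dt : (β → X) → (C → X), Eq17Local ℝ b₀ (fun c => ⇑(h c)) Ct r δ Dt ∧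
      fderiv ℝ (fderiv ℝ Dt) 0 = fderiv ℝ (fderiv ℝ Ct) 0 ∧
      ∀ p q : FormalMultilinearSeries ℝ (β → X) (C → X), HasFPowerSeriesAt Dt p 0 → HasFPowerSeriesAt Ct q 0 →
        HasFPowerSeriesAt Dt (q.comp ((ContinuousLinearMap.id ℝ (β → X)).fpowerSeries 0 -
          ((hOpLin b₀ h).mkContinuous b (norm_hOpLin_le b₀ h hb hh)).compFormalMultilinearSeries p)) 0 ∧
        ∀ A : β → X, p 2 (fun _ => A) = q 2 (fun _ => A) := by
  obtain ⟨r, δ, hδ, Dt, h17⟩ := exists_eq17Local_real b₀ h hR hCω hC0 hDC0 hb hh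
  set H : (C → X) →L[ℝ] (β → X) := (hOpLin b₀ h).mkContinuous b (norm_hOpLin_le b₀ h hb hh) with hHdef
  have hH : ∀ D, H D = hOpLin b₀ h D := fun D => LinearMap.mkContinuous_apply _ _ _ D
  have hCa0 : AnalyticAt ℝ Ct 0 := (hCω.contDiffAt (ball_mem_nhds (0 : β → X) hR)).analyticAt
  exact ⟨r, δ, hδ, Dt, h17, eq17Local_fderiv_fderiv_Dt_zero h17 H hH hCa0, fun p q hp hq' =>
    ⟨eq17Local_hasFPowerSeriesAt_recursive h17 H hH hp hq', fun A => eq17Local_coeff_two_diag h17 H hH hp hq' A⟩⟩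

end Instances

end Literature.MathematicalPhysics.QuantumFieldTheory.Balaban1983to89.B10Eq17RecursiveSystem
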